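import Summits.QuantumFields.BalabanUV.Beta.GAN24.LayerPushEntry
import Summits.QuantumFields.BalabanUV.Beta.GAN24.BlockDivergenceFlux

/-!
# `BalabanUV.Beta.GAN24.LayerCount` — binder row G-an2-4 / (CONV-C), W-slot CT-W, route «WC-TL» ∕ «QR-LL» (gan24-p1 g25 `gen25/QR-DESIGN-v0.md` §3 (LT) «the count of source
# slots feeding a target window is O(t·N^d) instead of O(N^{d+1})»; the OWNER gan24-p1 g26's exponent ledger W1 l.40158: the «−1 (slot sum restricted to the t-shell)»),
# row **(LT-Δ) «LAYER TRANSPORT»**, part (LT-2) — THE LAYER COUNT: the weighted block count `Σ'_u ω u·e^{−a‖quo N u − U‖₁}` of a BOUNDARY-LAYER weight is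
# `O(N^d)` per block (against `N^{d+1}·Zl` for a full block, `Push4TwoRate.tsum_block_four_le`)

NOT IN PRINT; OUR BOOKKEEPING ([folklore] finite sums and leaf-03's two-rate sum `Push4TwoRate.tsum_two_rate_le` ∕ face cardinality `BlockDivergenceFlux.card_face_eq` BY NAME;
G-an2-4 formalisation swarm, leaf prover `b2b-balaban-gan24-formalise-leaf-01`, gen 63).  HONEST FRAMING (cell contract, verbatim): «discharging `BetaPertH` makes
Bałaban's UV stability UNCONDITIONAL — a real constructive-QFT result; it is NOT the continuum limit and NOT the Clay problem.»  HONEST DEPENDENCY (verbatim): «continuum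
YM on T⁴ ⇐ BetaPertH ∧ nine spine estimates (0/9 proved); BetaPertH ⇐ (D1) ∧ (D4) ∧ CAP+tail; G-an2-4 gates asym, D1 and NE2/3/4.»

## What (generic `d`; the weight `ω` is the one the weighted push lemmas `LayerPushEntry.abs_push₃_inl_inl_le_weighted` ∕ `LayerPushFrozen.abs_push₃_sub_frozen_le_weighted` carry)
§1 `tsum_weight_mul_leg_le`: `0 ≤ ω u ≤ Cω·Σ_{w∈F} e^{−δ‖w−u‖₁}` (a weight dominated by the exponential bumps of a finite set `F` of LAYER SITES — leaf-03's exact face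
   weight of `LayerFluxSupport.biLoc_finsetSum_divV_weight`, or any witness-form weight `e^{−δ·R(u)}` it dominates) ⇒
   `Σ'_u ω u·e^{−a‖quo L u − U‖₁} ≤ Cω·Zl(δ∕2)·Σ_{w∈F} e^{−η‖quo L w − U‖₁}`, `η = min a (δ∕2)`; `sum_exp_quo_le_card` (sites within `ρ` labels of `q₀`:
   `≤ |F|·e^{ηρ}·e^{−η‖q₀−U‖₁}`); **`tsum_weight_mul_leg_le_card`** — the count is LINEAR IN `|F|`.
§2 one block of side `N` at label `y`: its boundary layer (the `2(d+1)` faces of `BlockDivergenceFlux.boxSum_sub_shift_eq_faces`: exiting `N•y + v`, `v_μ = N−1`; entering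
   `N•y + v − e_μ`, `v_μ = 0`) has `≤ N^d` sites per face (`card_faces_le`), all within ONE label of `y` (`l1_quo_faces_le`); hence **`layerCount_block`**:
   `Σ'_u ω u·e^{−a‖quo N u − U‖₁} ≤ (2(d+1))²·Zl(δ∕2)·N^d·e^{η}·e^{−η‖y − U‖₁}` for every weight dominated by that layer's bumps — `N^d`, NOT `N^{d+1}`.
[folklore]; 0 cited facts, 0 `def`, 0 `def … : Prop`, 0 sorry.  Asserts NOTHING about an2's towers; the exponent bookkeeping in (REP) currency is (LT-3); NEVER «G-an2-4 closed»
as (CONV-C); NOT D1, NOT `BetaPertH`, NOT continuum, NOT Clay.  2026-08-22.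
-/

noncomputable section

open Finset
open scoped BigOperators
open Literature.MathematicalPhysics.QuantumFieldTheory
open Literature.MathematicalPhysics.QuantumFieldTheory.Balaban1983to89
open Literature.MathematicalPhysics.QuantumFieldTheory.Balaban1983to89.Beta
open B12Sec2to5 (l1 l1_nonneg)
open B6BondElimination (unitVec)
open ExpKernelCalculus (Site Zl Zl_nonneg summable_exp_shift' tsum_exp_shift' l1_sub_triangle l1_sub_symm)
open LatticeForm (quo)
open AffineAveraging (box toSite)
open KKTFluctuationEnergy (quo_zsmul_add_toSite)
open Summit.QuantumFields.BalabanUV.Beta.GAN24.Push4TwoRate (summable_two_rate tsum_two_rate_le l1_quo_sub_quo_le_l1)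
open Summit.QuantumFields.BalabanUV.Beta.GAN24.BlockDivergenceFlux (card_face_eq)

namespace Summit.QuantumFields.BalabanUV.Beta.GAN24.LayerCount

variable {d : ℕ}

/-! ## §1 A weight dominated by a finite set of exponential bumps, against a block leg -/

/-- [folklore] **THE WEIGHTED BLOCK COUNT OF A LAYER WEIGHT**: if `0 ≤ ω u ≤ Cω·Σ_{w∈F} e^{−δ‖w−u‖₁}` for a finite set `F` of sites (`δ > 0`, `Cω ≥ 0`), then against
a block leg of rate `a ≥ 0` at blocking `L ≥ 1`,
`Σ'_u ω u·e^{−a‖quo L u − U‖₁} ≤ Cω·Zl_{d+1}(δ∕2)·Σ_{w∈F} e^{−min a (δ∕2)·‖quo L w − U‖₁}` — the weighted count is a sum over the SITES OF THE LAYER of the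
block leg at the halved rate (leaf-03's two-rate sum `Push4TwoRate.tsum_two_rate_le`, site by site). -/
theorem tsum_weight_mul_leg_le {L : ℕ} (hL : 1 ≤ L) {δ a Cω : ℝ} (hδ : 0 < δ) (ha : 0 ≤ a) (hC : 0 ≤ Cω) (F : Finset (Site (d + 1)))
    {ω : Site (d + 1) → ℝ} (hω : ∀ u, 0 ≤ ω u ∧ ω u ≤ Cω * ∑ w ∈ F, Real.exp (-δ * l1 (w - u))) (U : Site (d + 1)) :
    ∑' u, ω u * Real.exp (-a * l1 (quo L u - U))
      ≤ Cω * Zl (d + 1) (δ / 2) * ∑ w ∈ F, Real.exp (-(min a (δ / 2)) * l1 (quo L w - U)) := by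
  have hterm : ∀ w, Summable fun u : Site (d + 1) => Real.exp (-a * l1 (quo L u - U)) * Real.exp (-δ * l1 (u - w)) :=
    fun w => summable_two_rate ha hδ w U
  have hsumF : Summable fun u : Site (d + 1) => Cω * ∑ w ∈ F, Real.exp (-a * l1 (quo L u - U)) * Real.exp (-δ * l1 (u - w)) :=
    (summable_sum fun w _ => hterm w).mul_left Cω
  have hle : ∀ u, ω u * Real.exp (-a * l1 (quo L u - U))
      ≤ Cω * ∑ w ∈ F, Real.exp (-a * l1 (quo L u - U)) * Real.exp (-δ * l1 (u - w)) := by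
    intro u
    have e : Cω * ∑ w ∈ F, Real.exp (-a * l1 (quo L u - U)) * Real.exp (-δ * l1 (u - w))
        = (Cω * ∑ w ∈ F, Real.exp (-δ * l1 (w - u))) * Real.exp (-a * l1 (quo L u - U)) := by
      rw [Finset.mul_sum, Finset.mul_sum, Finset.sum_mul]
      refine Finset.sum_congr rfl fun w _ => ?_
      rw [l1_sub_symm u w]; ring
    rw [e]
    exact mul_le_mul_of_nonneg_right (hω u).2 (Real.exp_pos _).le
  have h0 : ∀ u, 0 ≤ ω u * Real.exp (-a * l1 (quo L u - U)) := fun u => mul_nonneg (hω u).1 (Real.exp_pos _).le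
  calc ∑' u, ω u * Real.exp (-a * l1 (quo L u - U))
      ≤ ∑' u, Cω * ∑ w ∈ F, Real.exp (-a * l1 (quo L u - U)) * Real.exp (-δ * l1 (u - w)) :=
        Summable.tsum_le_tsum hle (Summable.of_nonneg_of_le h0 hle hsumF) hsumF
    _ = Cω * ∑ w ∈ F, ∑' u, Real.exp (-a * l1 (quo L u - U)) * Real.exp (-δ * l1 (u - w)) := by
        rw [tsum_mul_left, Summable.tsum_finsetSum fun w _ => hterm w]
    _ ≤ Cω * ∑ w ∈ F, Zl (d + 1) (δ / 2) * Real.exp (-(min a (δ / 2)) * l1 (quo L w - U)) :=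
        mul_le_mul_of_nonneg_left (Finset.sum_le_sum fun w _ => tsum_two_rate_le hL ha hδ w U) hC
    _ = _ := by rw [← Finset.mul_sum, mul_assoc]

/-- [folklore] **A FINITE SET OF SITES NEAR ONE BLOCK LABEL**: if every `w ∈ F` has `‖quo L w − q₀‖₁ ≤ ρ` then
`Σ_{w∈F} e^{−η‖quo L w − U‖₁} ≤ |F|·e^{ηρ}·e^{−η‖q₀ − U‖₁}` (`η ≥ 0`). -/
theorem sum_exp_quo_le_card {L : ℕ} {η ρ : ℝ} (hη : 0 ≤ η) (F : Finset (Site (d + 1))) (q₀ U : Site (d + 1))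
    (hF : ∀ w ∈ F, l1 (quo L w - q₀) ≤ ρ) :
    ∑ w ∈ F, Real.exp (-η * l1 (quo L w - U)) ≤ (F.card : ℝ) * (Real.exp (η * ρ) * Real.exp (-η * l1 (q₀ - U))) := by
  have hle : ∀ w ∈ F, Real.exp (-η * l1 (quo L w - U)) ≤ Real.exp (η * ρ) * Real.exp (-η * l1 (q₀ - U)) := by
    intro w hw
    rw [← Real.exp_add, Real.exp_le_exp]
    have t : l1 (q₀ - U) ≤ l1 (q₀ - quo L w) + l1 (quo L w - U) := l1_sub_triangle _ _ _
    rw [l1_sub_symm q₀ (quo L w)] at t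
    nlinarith [hF w hw]
  calc ∑ w ∈ F, Real.exp (-η * l1 (quo L w - U)) ≤ ∑ _w ∈ F, Real.exp (η * ρ) * Real.exp (-η * l1 (q₀ - U)) := Finset.sum_le_sum hle
    _ = _ := by rw [Finset.sum_const, nsmul_eq_mul]

/-- [folklore] **THE LAYER COUNT, ABSTRACT FORM**: a weight dominated by `Cω` times the exponential bumps of a finite set `F` of sites all within one block label of
`q₀` (`‖quo L w − q₀‖₁ ≤ ρ`) has weighted block count `≤ Cω·Zl(δ∕2)·|F|·e^{ηρ}·e^{−η‖q₀ − U‖₁}`, `η := min a (δ∕2)` — LINEAR IN THE NUMBER OF LAYER SITES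
(for the boundary layer of one block of side `N`: `|F| ≤ 2(d+1)·N^d`, `layerCount_block`), against `N^{d+1}·Zl` for a full block. -/
theorem tsum_weight_mul_leg_le_card {L : ℕ} (hL : 1 ≤ L) {δ a Cω ρ : ℝ} (hδ : 0 < δ) (ha : 0 ≤ a) (hC : 0 ≤ Cω)
    (F : Finset (Site (d + 1))) (q₀ : Site (d + 1)) (hF : ∀ w ∈ F, l1 (quo L w - q₀) ≤ ρ)
    {ω : Site (d + 1) → ℝ} (hω : ∀ u, 0 ≤ ω u ∧ ω u ≤ Cω * ∑ w ∈ F, Real.exp (-δ * l1 (w - u))) (U : Site (d + 1)) :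
    ∑' u, ω u * Real.exp (-a * l1 (quo L u - U))
      ≤ Cω * Zl (d + 1) (δ / 2) * ((F.card : ℝ) * (Real.exp ((min a (δ / 2)) * ρ) * Real.exp (-(min a (δ / 2)) * l1 (q₀ - U)))) := by
  refine (tsum_weight_mul_leg_le hL hδ ha hC F hω U).trans ?_
  exact mul_le_mul_of_nonneg_left (sum_exp_quo_le_card (le_min ha (by linarith)) F q₀ U hF)
    (mul_nonneg hC (Zl_nonneg (by linarith)))

/-! ## §2 The boundary layer of one block: `2(d+1)` faces of `N^d` sites, all within one label of the block -/

/-- [folklore] The EXITING `μ`-face of the block of label `y` at blocking `N` (inner face: the sites `N•y + v`, `v_μ = N−1`) and the ENTERING `μ`-face (outer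
face: the sites `N•y + v − e_μ`, `v_μ = 0`) — the index sets of `BlockDivergenceFlux.boxSum_sub_shift_eq_faces` — each have at most `N^d` sites. -/
theorem card_faces_le {N : ℕ} (hN : 1 ≤ N) (y : Site (d + 1)) (μ : Fin (d + 1)) :
    (((box (d + 1) N).filter (fun v => v μ = N - 1)).image (fun v => (N : ℤ) • y + toSite v)).card ≤ N ^ d ∧
    (((box (d + 1) N).filter (fun v => v μ = 0)).image (fun v => (N : ℤ) • y + toSite v - unitVec μ)).card ≤ N ^ d := by
  constructor
  · refine Finset.card_image_le.trans (le_of_eq (card_face_eq (by omega) μ))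
  · refine Finset.card_image_le.trans (le_of_eq (card_face_eq (by omega) μ))

/-- [folklore] Every site of the two `μ`-faces of the block of label `y` has block label within `1` of `y`. -/
theorem l1_quo_faces_le {N : ℕ} (hN : 1 ≤ N) (y : Site (d + 1)) (μ : Fin (d + 1)) (w : Site (d + 1))
    (hw : w ∈ ((box (d + 1) N).filter (fun v => v μ = N - 1)).image (fun v => (N : ℤ) • y + toSite v)
      ∨ w ∈ ((box (d + 1) N).filter (fun v => v μ = 0)).image (fun v => (N : ℤ) • y + toSite v - unitVec μ)) :
    l1 (quo N w - y) ≤ 1 := by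
  haveI : NeZero N := ⟨by omega⟩
  rcases hw with hw | hw
  · obtain ⟨v, hv, rfl⟩ := Finset.mem_image.1 hw
    rw [quo_zsmul_add_toSite y (Finset.mem_filter.1 hv).1, sub_self]
    simp [l1]
  · obtain ⟨v, hv, rfl⟩ := Finset.mem_image.1 hw
    have hq : quo N ((N : ℤ) • y + toSite v) = y := quo_zsmul_add_toSite y (Finset.mem_filter.1 hv).1
    have h1 : l1 (quo N ((N : ℤ) • y + toSite v - unitVec μ) - quo N ((N : ℤ) • y + toSite v))
        ≤ l1 (((N : ℤ) • y + toSite v - unitVec μ) - ((N : ℤ) • y + toSite v)) := l1_quo_sub_quo_le_l1 hN _ _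
    rw [hq] at h1
    refine h1.trans ?_
    rw [show ((N : ℤ) • y + toSite v - unitVec μ) - ((N : ℤ) • y + toSite v) = -unitVec μ by abel]
    have : l1 (-unitVec μ : Site (d + 1)) = l1 (unitVec μ : Site (d + 1)) := by unfold l1; simp
    rw [this, StepJetData.l1_unitVec]

/-- NOT IN PRINT; OUR BOOKKEEPING.  **THE LAYER COUNT FOR ONE BLOCK** (the `t·L^d` of the OWNER gan24-p1 g26's exponent ledger W1, with `t = 1` per face layer): a weight
dominated by the exponential bumps of the boundary layer of the block of label `y` at blocking `N ≥ 1` — the union over `μ` of the exiting and entering `μ`-faces,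
`ω u ≤ Σ_μ (Σ_{exiting μ-face} + Σ_{entering μ-face}) e^{−δ‖w−u‖₁}` (leaf-03's exact face weight of `LayerFluxSupport.biLoc_finsetSum_divV_weight` at a block, or any
witness-form weight it dominates) — has weighted block count
`Σ'_u ω u·e^{−a‖quo N u − U‖₁} ≤ (2(d+1))²·Zl_{d+1}(δ∕2)·N^d·e^{η}·e^{−η‖y − U‖₁}`, `η := min a (δ∕2)`: `N^d` PER FACE (`2(d+1)` faces, one more `2(d+1)`
from dominating the face-by-face weight by the layer's), not `N^{d+1}`. -/
theorem layerCount_block {N : ℕ} (hN : 1 ≤ N) {δ a : ℝ} (hδ : 0 < δ) (ha : 0 ≤ a) (y : Site (d + 1)) {ω : Site (d + 1) → ℝ}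
    (hω : ∀ u, 0 ≤ ω u ∧ ω u ≤ ∑ μ : Fin (d + 1),
      (∑ w ∈ ((box (d + 1) N).filter (fun v => v μ = N - 1)).image (fun v => (N : ℤ) • y + toSite v), Real.exp (-δ * l1 (w - u))
        + ∑ w ∈ ((box (d + 1) N).filter (fun v => v μ = 0)).image (fun v => (N : ℤ) • y + toSite v - unitVec μ),
            Real.exp (-δ * l1 (w - u))))
    (U : Site (d + 1)) :
    ∑' u, ω u * Real.exp (-a * l1 (quo N u - U))
      ≤ (2 * ((d : ℝ) + 1)) ^ 2 * Zl (d + 1) (δ / 2) * (N : ℝ) ^ d *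
          (Real.exp (min a (δ / 2)) * Real.exp (-(min a (δ / 2)) * l1 (y - U))) := by
  classical
  -- the layer as ONE finite set (a union; overlaps only help)
  set F : Finset (Site (d + 1)) := (Finset.univ : Finset (Fin (d + 1))).biUnion fun μ =>
    ((box (d + 1) N).filter (fun v => v μ = N - 1)).image (fun v => (N : ℤ) • y + toSite v)
      ∪ ((box (d + 1) N).filter (fun v => v μ = 0)).image (fun v => (N : ℤ) • y + toSite v - unitVec μ) with hF
  have hη0 : 0 ≤ min a (δ / 2) := le_min ha (by linarith)
  -- domination of the face-by-face sum by the sum over the union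
  have hdom : ∀ u, (∑ μ : Fin (d + 1),
      (∑ w ∈ ((box (d + 1) N).filter (fun v => v μ = N - 1)).image (fun v => (N : ℤ) • y + toSite v), Real.exp (-δ * l1 (w - u))
        + ∑ w ∈ ((box (d + 1) N).filter (fun v => v μ = 0)).image (fun v => (N : ℤ) • y + toSite v - unitVec μ),
            Real.exp (-δ * l1 (w - u))))
      ≤ (2 * ((d : ℝ) + 1)) * ∑ w ∈ F, Real.exp (-δ * l1 (w - u)) := by
    intro u
    have hsub1 : ∀ μ, ((box (d + 1) N).filter (fun v => v μ = N - 1)).image (fun v => (N : ℤ) • y + toSite v) ⊆ F := by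
      intro μ p hp
      rw [hF, Finset.mem_biUnion]
      exact ⟨μ, Finset.mem_univ μ, Finset.mem_union_left _ hp⟩
    have hsub2 : ∀ μ, ((box (d + 1) N).filter (fun v => v μ = 0)).image (fun v => (N : ℤ) • y + toSite v - unitVec μ) ⊆ F := by
      intro μ p hp
      rw [hF, Finset.mem_biUnion]
      exact ⟨μ, Finset.mem_univ μ, Finset.mem_union_right _ hp⟩
    have hface : ∀ μ, (∑ w ∈ ((box (d + 1) N).filter (fun v => v μ = N - 1)).image (fun v => (N : ℤ) • y + toSite v),
          Real.exp (-δ * l1 (w - u))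
        + ∑ w ∈ ((box (d + 1) N).filter (fun v => v μ = 0)).image (fun v => (N : ℤ) • y + toSite v - unitVec μ),
            Real.exp (-δ * l1 (w - u)))
        ≤ 2 * ∑ w ∈ F, Real.exp (-δ * l1 (w - u)) := by
      intro μ
      have h1 := Finset.sum_le_sum_of_subset_of_nonneg (hsub1 μ) (f := fun w => Real.exp (-δ * l1 (w - u)))
        (fun w _ _ => (Real.exp_pos _).le)
      have h2 := Finset.sum_le_sum_of_subset_of_nonneg (hsub2 μ) (f := fun w => Real.exp (-δ * l1 (w - u)))
        (fun w _ _ => (Real.exp_pos _).le)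
      linarith
    calc _ ≤ ∑ _μ : Fin (d + 1), 2 * ∑ w ∈ F, Real.exp (-δ * l1 (w - u)) := Finset.sum_le_sum fun μ _ => hface μ
      _ = _ := by rw [Finset.sum_const, Finset.card_univ, Fintype.card_fin, nsmul_eq_mul]; push_cast; ring
  -- the abstract count with `Cω := 2(d+1)`
  have hD : (0 : ℝ) ≤ 2 * ((d : ℝ) + 1) := by positivity
  have hω' : ∀ u, 0 ≤ ω u ∧ ω u ≤ (2 * ((d : ℝ) + 1)) * ∑ w ∈ F, Real.exp (-δ * l1 (w - u)) :=
    fun u => ⟨(hω u).1, (hω u).2.trans (hdom u)⟩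
  have hFq : ∀ w ∈ F, l1 (quo N w - y) ≤ 1 := by
    intro w hw
    rw [hF, Finset.mem_biUnion] at hw
    obtain ⟨μ, -, hμ⟩ := hw
    rcases Finset.mem_union.1 hμ with h | h
    · exact l1_quo_faces_le hN y μ w (Or.inl h)
    · exact l1_quo_faces_le hN y μ w (Or.inr h)
  have hcard : (F.card : ℝ) ≤ 2 * ((d : ℝ) + 1) * (N : ℝ) ^ d := by
    have h1 : F.card ≤ ∑ μ : Fin (d + 1), (N ^ d + N ^ d) := by
      rw [hF]
      refine Finset.card_biUnion_le.trans (Finset.sum_le_sum fun μ _ => ?_)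
      refine (Finset.card_union_le _ _).trans ?_
      exact add_le_add (card_faces_le hN y μ).1 (card_faces_le hN y μ).2
    have h2 : ((∑ μ : Fin (d + 1), (N ^ d + N ^ d) : ℕ) : ℝ) = 2 * ((d : ℝ) + 1) * (N : ℝ) ^ d := by
      rw [Finset.sum_const, Finset.card_univ, Fintype.card_fin, smul_eq_mul]; push_cast; ring
    exact_mod_cast (Nat.cast_le.2 h1).trans (le_of_eq h2)
  have hmain := tsum_weight_mul_leg_le_card hN hδ ha hD F y hFq hω' U
  rw [mul_one] at hmain
  refine hmain.trans ?_
  have hZ : 0 ≤ Zl (d + 1) (δ / 2) := Zl_nonneg (by linarith)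
  have hE : 0 ≤ Real.exp (min a (δ / 2)) * Real.exp (-(min a (δ / 2)) * l1 (y - U)) := by positivity
  calc 2 * ((d : ℝ) + 1) * Zl (d + 1) (δ / 2) * ((F.card : ℝ) * (Real.exp (min a (δ / 2)) * Real.exp (-(min a (δ / 2)) * l1 (y - U))))
      ≤ 2 * ((d : ℝ) + 1) * Zl (d + 1) (δ / 2) * ((2 * ((d : ℝ) + 1) * (N : ℝ) ^ d) *
          (Real.exp (min a (δ / 2)) * Real.exp (-(min a (δ / 2)) * l1 (y - U)))) :=
        mul_le_mul_of_nonneg_left (mul_le_mul_of_nonneg_right hcard hE) (by positivity)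
    _ = _ := by ring

end Summit.QuantumFields.BalabanUV.Beta.GAN24.LayerCount

end
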